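import Mathlib
import HarnessLib
import Summits.FinalStateConjecture.Statement
import Literature.Geometry.Lorentzian.ReggeWheelerTortoise
import Literature.Geometry.Lorentzian.ReggeWheelerChannels

/-!
# Route PhotonSphereChannels — the Assembly re-typed for the T2 summit statement (repair kit, 2026-08-16)

On 2026-08-16T21:18Z the summit statement `FinalStateConjecture`
(`Summits/FinalStateConjecture/FinalStateConjecture/Statement.lean`) was RE-TYPED after the semantic-vacuity
audit (`docs/m5/STATEMENT-SEMANTIC-VACUITY-AUDIT-2026-08-16.md` §2.1, re-type T2): genericity is now the TAME
notion `InitialDataSet.IsTameChristodoulouGeneric` (one fixed end, continuous mass, weighted continuity,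
immersion at the base point), `HasExhaustiveCharts` carries honest near-zone radii, and the post-maximality
conclusion gained two clauses — the intrinsic lower bound on the settled region
`Summit.FinalStateConjecture.RaysStayInClosure 𝒟 O` and the chart time orientation
`Summit.FinalStateConjecture.IsFutureOriented d`.

The route's rev-7 frame assembly `Theorems.PhotonSphereChannels.assemblyR_frame_proof`
(`PhotonSphereChannelsAssemblyFrameR.lean`: `K1R ∧ K2R ∧ K3 → FinalStateConjecture` with the bodies of
`UniformPhotonSphereChannelsR`, `ChannelsResolveTameDevelopmentsR`, `TameCensorship` inlined) no longer
elaborates against the re-typed summit (farm probe 2026-08-16T21:3xZ: type mismatch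
`IsChristodoulouGeneric … / IsTameChristodoulouGeneric …` at its line 79), so the route's deciding chain is
broken until the two nonlinear cruxes are restated.  This module is the REPAIRED frame, with the minimal
restatements that make the chain close again, written out verbatim so that a restated route `Assembly` of
the same shape unfolds to it by `δ`-reduction alone (Theses-free, no import of the route module — the same
design constraint as `PhotonSphereChannelsAssemblyFrame{,R}.lean`, avoiding the `_holds` render import cycle):

* K1R  = `UniformPhotonSphereChannelsR` — UNCHANGED (a theorem of the tree, item 14074);
* K2R″ = `ChannelsResolveTameDevelopmentsR` with the consequent re-typed to the T2 conclusion: for every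
  admissible datum, every MGHD with complete `𝓘⁺` satisfying (i) no extremal remnant and (ii) tame outer
  geometry, `∃ O d, O = exteriorOf 𝒟 d.charted ∧ RaysStayInClosure 𝒟 O ∧ HasExhaustiveCharts d ∧
  IsFutureOriented d` (the hypotheses (i), (ii) are byte-identical to rev 7; sub-extremality of the holes is
  NOT put into K2R″ — it still follows in the frame from `|aᵢ| ≤ Mᵢ` and (i));
* K3″  = `TameCensorship` with `IsChristodoulouGeneric` replaced by `IsTameChristodoulouGeneric` (property
  byte-identical to rev 7).

The proof is the same pure logic as rev 7: tame Christodoulou-genericity in curve form is monotone in the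
property (the witnessing end, family, tameness and immersion are kept; only the exceptional-set membership
is transported), and pointwise on admissible data K2R″ fed with K1R turns (complete `𝓘⁺` ∧ (i) ∧ (ii)) into
the T2 conclusion, each hole being sub-extremal because `|aᵢ| = Mᵢ` would exhibit an extremal remnant.
No analysis, no new definitions; nothing here bears on the truth of K1R, K2R″ or K3″.
-/

set_option linter.dupNamespace false

namespace Summit.FinalStateConjecture.FinalStateConjecture.Theorems

open scoped BigOperators Topology Manifold Classical MeasureTheory ProbabilityTheory Matrix InnerProductSpace ComplexConjugate ContinuousMap
open Filter Set Function TopologicalSpace MeasureTheory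

/-- **Assembly of route PhotonSphereChannels re-typed for the T2 summit statement** (repair after the
re-type of 2026-08-16T21:18Z): `(K1R ∧ K2R″ ∧ K3″) → FinalStateConjecture` with K1R =
`UniformPhotonSphereChannelsR` (unchanged: log-ball two-ended channel-of-energy inequality for the
Regge–Wheeler family), K2R″ = `ChannelsResolveTameDevelopmentsR` with consequent
`∃ O d, O = exteriorOf 𝒟 d.charted ∧ RaysStayInClosure 𝒟 O ∧ HasExhaustiveCharts d ∧ IsFutureOriented d`,
and K3″ = `TameCensorship` over `IsTameChristodoulouGeneric`, all three written out verbatim.  Proof: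
tame genericity is monotone in the property; pointwise on admissible data K2R″ (fed with K1R) turns the tame
property into the T2 final-state property, sub-extremality of every hole coming from `|aᵢ| ≤ Mᵢ` and the
no-extremal-remnant clause. [folklore] -/
theorem PhotonSphereChannels.assemblyT2_frame_proof :
    (∀ M : ℝ, 0 < M → ∃ ρ₀ : ℝ, 0 ≤ ρ₀ ∧ ∃ C : ℝ, 0 ≤ C ∧ ∃ c : ℝ, 0 < c ∧ ∀ (r : ℝ → ℝ) (xc : ℝ), Literature.Geometry.Lorentzian.ReggeWheeler.IsTortoiseRadius M r xc → ∀ (s ℓ : ℕ), s ≤ 2 → s ≤ ℓ → ∀ ρ : ℝ, ρ₀ + C * Real.log ((ℓ : ℝ) + 1) ≤ ρ → Literature.Geometry.Lorentzian.ReggeWheeler.ChannelInequality (Literature.Geometry.Lorentzian.ReggeWheeler.linePotential M s ℓ r) xc ρ c) ∧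
    ((∀ M : ℝ, 0 < M → ∃ ρ₀ : ℝ, 0 ≤ ρ₀ ∧ ∃ C : ℝ, 0 ≤ C ∧ ∃ c : ℝ, 0 < c ∧ ∀ (r : ℝ → ℝ) (xc : ℝ), Literature.Geometry.Lorentzian.ReggeWheeler.IsTortoiseRadius M r xc → ∀ (s ℓ : ℕ), s ≤ 2 → s ≤ ℓ → ∀ ρ : ℝ, ρ₀ + C * Real.log ((ℓ : ℝ) + 1) ≤ ρ → Literature.Geometry.Lorentzian.ReggeWheeler.ChannelInequality (Literature.Geometry.Lorentzian.ReggeWheeler.linePotential M s ℓ r) xc ρ c) →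
      ∀ (X : Type) [TopologicalSpace X] [ChartedSpace Literature.Geometry.Lorentzian.E3 X] [IsManifold (modelWithCornersSelf ℝ Literature.Geometry.Lorentzian.E3) ((⊤ : ℕ∞) : WithTop ℕ∞) X] [T2Space X] [SecondCountableTopology X] [ConnectedSpace X], ∀ D ∈ Literature.Geometry.Lorentzian.admissibleVacuumData X, ∀ 𝒟 : Literature.Geometry.Lorentzian.VacuumCauchyDevelopment D, 𝒟.IsMaximal → _root_.Summit.FinalStateConjecture.HasCompleteNullInfinity 𝒟.toCauchyDevelopment → ((∀ (Λ : Literature.Geometry.Lorentzian.lorentzGroup) (c : Literature.Geometry.Lorentzian.E4) (M a : ℝ), Literature.Geometry.Lorentzian.Kerr.IsExtremal M a → ¬ ∃ (τ₀ : ℝ) (Ψ : (Literature.Geometry.Lorentzian.boostedKerrBackground Λ c M a).domain → 𝒟.carrier), 𝒟.toSpacetime.IsLateChart (Literature.Geometry.Lorentzian.boostedKerrBackground Λ c M a) Set.univ τ₀ Ψ ∧ ∀ R : ℝ, Filter.Tendsto (fun τ => 𝒟.toSpacetime.truncDeviationCk (Literature.Geometry.Lorentzian.boostedKerrBackground Λ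 c M a) Ψ 2 R τ) Filter.atTop (nhds 0)) ∧ ∀ [𝒟.metric.HasLeviCivita], let outer : Set 𝒟.carrier := 𝒟.metric.causalFuture 𝒟.timeOrientation (Set.range 𝒟.embed) ∩ {q | ∃ (p : X) (γ : ℝ → 𝒟.carrier) (dom : Set ℝ), 𝒟.metric.IsNormalisedNullRayFrom 𝒟.timeOrientation 𝒟.embed 𝒟.normal p γ dom ∧ ¬ BddAbove dom ∧ q ∈ 𝒟.metric.chronologicalPast 𝒟.timeOrientation (γ '' (dom ∩ Set.Ici 0))}; ∃ r₀ : ℝ, 0 < r₀ ∧ ∃ Λ : NNReal, ∀ q ∈ outer, let U : TopologicalSpace.Opens Literature.Geometry.Lorentzian.E4 := ⟨Metric.ball (0 : Literature.Geometry.Lorentzian.E4) r₀, Metric.isOpen_ball⟩; ∃ Ψ : U → 𝒟.carrier, 𝒟.toSpacetime.IsLateChart (Literature.Geometry.Lorentzian.Minkowski.backgroundOn U) Set.univ (-r₀) Ψ ∧ (∃ x : U, (x : Literature.Geometry.Lorentzian.E4) = 0 ∧ Ψ x = q) ∧ Literature.Geometry.Lorentzian.supCkENorm (U : Set Literature.Geometry.Lorentzian.E4)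 3 (𝒟.toSpacetime.deviationExtend (Literature.Geometry.Lorentzian.Minkowski.backgroundOn U) Ψ) ≤ (Λ : ENNReal) ∧ Literature.Geometry.Lorentzian.supCkENorm (U : Set Literature.Geometry.Lorentzian.E4) 0 (𝒟.toSpacetime.deviationExtend (Literature.Geometry.Lorentzian.Minkowski.backgroundOn U) Ψ) ≤ 1 / 2) → ∃ (O : Set 𝒟.carrier) (d : Literature.Geometry.Lorentzian.FinalStateDecomposition 𝒟.toSpacetime O 2), O = _root_.Summit.FinalStateConjecture.exteriorOf 𝒟.toCauchyDevelopment d.charted ∧ _root_.Summit.FinalStateConjecture.RaysStayInClosure 𝒟.toCauchyDevelopment O ∧ _root_.Summit.FinalStateConjecture.HasExhaustiveCharts d ∧ _root_.Summit.FinalStateConjecture.IsFutureOriented d) ∧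
    (∀ (X : Type) [TopologicalSpace X] [ChartedSpace Literature.Geometry.Lorentzian.E3 X] [IsManifold (modelWithCornersSelf ℝ Literature.Geometry.Lorentzian.E3) ((⊤ : ℕ∞) : WithTop ℕ∞) X] [T2Space X] [SecondCountableTopology X] [ConnectedSpace X], Literature.Geometry.Lorentzian.InitialDataSet.IsTameChristodoulouGeneric (Literature.Geometry.Lorentzian.admissibleVacuumData X) (fun D => (∃ 𝒟 : Literature.Geometry.Lorentzian.VacuumCauchyDevelopment D, 𝒟.IsMaximal) ∧ ∀ 𝒟 : Literature.Geometry.Lorentzian.VacuumCauchyDevelopment D, 𝒟.IsMaximal → _root_.Summit.FinalStateConjecture.HasCompleteNullInfinity 𝒟.toCauchyDevelopment ∧ ((∀ (Λ : Literature.Geometry.Lorentzian.lorentzGroup) (c : Literature.Geometry.Lorentzian.E4) (M a : ℝ), Literature.Geometry.Lorentzian.Kerr.IsExtremal M a → ¬ ∃ (τ₀ : ℝ) (Ψ : (Literature.Geometry.Lorentzian.boostedKerrBackground Λ c M a).domain → 𝒟.carrier), 𝒟.toSpacetime.IsLateChart (Literature.Geometry.Lorentzian.boostedKerrBackground Λ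 c M a) Set.univ τ₀ Ψ ∧ ∀ R : ℝ, Filter.Tendsto (fun τ => 𝒟.toSpacetime.truncDeviationCk (Literature.Geometry.Lorentzian.boostedKerrBackground Λ c M a) Ψ 2 R τ) Filter.atTop (nhds 0)) ∧ ∀ [𝒟.metric.HasLeviCivita], let outer : Set 𝒟.carrier := 𝒟.metric.causalFuture 𝒟.timeOrientation (Set.range 𝒟.embed) ∩ {q | ∃ (p : X) (γ : ℝ → 𝒟.carrier) (dom : Set ℝ), 𝒟.metric.IsNormalisedNullRayFrom 𝒟.timeOrientation 𝒟.embed 𝒟.normal p γ dom ∧ ¬ BddAbove dom ∧ q ∈ 𝒟.metric.chronologicalPast 𝒟.timeOrientation (γ '' (dom ∩ Set.Ici 0))}; ∃ r₀ : ℝ, 0 < r₀ ∧ ∃ Λ : NNReal, ∀ q ∈ outer, let U : TopologicalSpace.Opens Literature.Geometry.Lorentzian.E4 := ⟨Metric.ball (0 : Literature.Geometry.Lorentzian.E4) r₀, Metric.isOpen_ball⟩; ∃ Ψ : U → 𝒟.carrier, 𝒟.toSpacetime.IsLateChart (Literature.Geometry.Lorentzian.Minkowski.backgroundOn U) Set.univ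 (-r₀) Ψ ∧ (∃ x : U, (x : Literature.Geometry.Lorentzian.E4) = 0 ∧ Ψ x = q) ∧ Literature.Geometry.Lorentzian.supCkENorm (U : Set Literature.Geometry.Lorentzian.E4) 3 (𝒟.toSpacetime.deviationExtend (Literature.Geometry.Lorentzian.Minkowski.backgroundOn U) Ψ) ≤ (Λ : ENNReal) ∧ Literature.Geometry.Lorentzian.supCkENorm (U : Set Literature.Geometry.Lorentzian.E4) 0 (𝒟.toSpacetime.deviationExtend (Literature.Geometry.Lorentzian.Minkowski.backgroundOn U) Ψ) ≤ 1 / 2)) 1) →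
    _root_.FinalStateConjecture := by
  rintro ⟨h₁, h₂, h₃⟩ X i₁ i₂ i₃ i₄ i₅ i₆
  -- tame Christodoulou-genericity (codimension 1, curve form, one fixed end) is monotone in the property
  have mono : ∀ {P Q : _ → Prop},
      (∀ D ∈ Literature.Geometry.Lorentzian.admissibleVacuumData X, Q D → P D) →
      Literature.Geometry.Lorentzian.InitialDataSet.IsTameChristodoulouGeneric
        (Literature.Geometry.Lorentzian.admissibleVacuumData X) Q 1 →
      Literature.Geometry.Lorentzian.InitialDataSet.IsTameChristodoulouGeneric
        (Literature.Geometry.Lorentzian.admissibleVacuumData X) P 1 := by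
    intro P Q hQP hQ D hD
    obtain ⟨e, F, hF, himm, h0, hinj, hadm, hexc⟩ := hQ D ⟨hD.1, fun h => hD.2 (hQP D hD.1 h)⟩
    exact ⟨e, F, hF, himm, h0, hinj, hadm,
      fun c hc hmem => hexc c hc ⟨hmem.1, fun h => hmem.2 (hQP _ hmem.1 h)⟩⟩
  refine mono ?_ (h₃ X)
  -- pointwise on admissible data: (MGHD exists) ∧ (complete 𝓘⁺ ∧ tame) ⇒ the T2 final-state property;
  -- the linear input K1R feeds the re-typed conditional resolution K2R″
  rintro D hD ⟨hex, hQ⟩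
  refine ⟨hex, fun 𝒟 hmax => ?_⟩
  obtain ⟨hcomp, htame⟩ := hQ 𝒟 hmax
  obtain ⟨O, d, hO, hrays, hexh, hfo⟩ := h₂ h₁ X D hD 𝒟 hmax hcomp htame
  refine ⟨hcomp, O, d, fun i => ?_, hO, hrays, hexh, hfo⟩
  -- sub-extremality of every hole: |aᵢ| ≤ Mᵢ structurally, and |aᵢ| = Mᵢ is an extremal remnant
  rcases lt_or_eq_of_le (d.abs_spin_le_mass i) with hlt | heq
  · exact hlt
  · exact absurd ⟨d.τ₀, d.chart i, ⟨(d.isLateChart i).contMDiff, (d.isLateChart i).isOpenEmbedding,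
        Set.subset_univ _⟩, d.tendsto_truncDeviationCk i⟩
      (htame.1 (d.motion i).1 (d.motion i).2 (d.mass i) (d.spin i) ⟨heq, d.mass_pos i⟩)

end Summit.FinalStateConjecture.FinalStateConjecture.Theorems
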